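import Mathlib
import HarnessLib
import Literature.MathematicalPhysics.KineticTheory.HardSphereEulerProofs
import Summits.AtomisticToContinuum.HydrodynamicLimit.Theorems.KineticFluxLdDecay.Negative.TiltBasics

/-!
# Gaussian quadratic-form moments (helper file A of stub `stub_classTruncation`, line `Sketch`,
# crux `KineticCurrentsWindowLDUniform`, stmt-AtomisticToContinuum-14662)

Static Gaussian moment algebra on `ℝ³` under the standard Gaussian `γ`, used by the class
truncation (files `…ClassTruncationReduced.lean`, `…ClassTruncation.lean`):

* integrability by polynomial domination `|h| ≤ K(1+‖ξ‖²)³` (Fernique moments);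
* reflections and swaps: `E[ξ_j ξ_k ω(‖ξ‖²)] = δ_{jk} E[ξ_0² ω]`, hence
  `∫ (∑ A_{jk} ξ_j ξ_k) ω(‖ξ‖²) dγ = tr A · E[ξ_0² ω]` (registered helper stub
  `stub_classTruncation_gauss`) and `∫ (b·ξ) ξ_j ω dγ = b_j E[ξ_0² ω]`;
* even and first moments of a CLASS-FORM functional
  `h(ξ) = θ (∑ A_{jk} ξ_j ξ_k) κ(‖ξ‖²) + √θ (b·ξ) λ(‖ξ‖²)` (the crux's class in the reduced variable);
* the reference radial moment `m₀ = E[ξ_0²(1+‖ξ‖²)⁻¹] > 0`, the convexity bound behind the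
  exponential-moment estimate, and the properties of the cutoff `χ_L(s) = min 1 (max 0 (2 − s/L))`.

The reflection/swap algebra is adapted from `Cruxes/KineticCurrentsWindowLDUniform/Disproof.lean`
§ KineticCurrentsWindowLDUniformClass (refuter cdisprove-14662) and `BoltzmannGreenKubo/Negative/ForallN`
(coordinate reflections written as explicit `piLpCongrRight` terms: no definitions are introduced).
-/

noncomputable section

open MeasureTheory Set Filter
open scoped ENNReal Topology

namespace Summit.AtomisticToContinuum.HydrodynamicLimit.Theorems.KineticCurrentsWindowLDUniformSketch

open Literature.Analysis.FluidPDE (HardSphereFlow Config localMaxwellian)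
open Literature.MathematicalPhysics.KineticTheory (T3 V3 hsDiameter localGibbsLaw localGibbsMeasure)
open Literature.MathematicalPhysics.KineticTheory (integral_coord_sq_stdGaussian
  integrable_norm_sq_stdGaussian integrable_norm_pow_four_stdGaussian)
open ProbabilityTheory
open KineticFluxLdDecayTilt (integral_comp_linearIsometryEquiv_stdGaussian
  integral_eq_zero_of_odd_stdGaussian)

namespace ClassTruncation

/-! ### Gaussian integrability by polynomial domination -/

/-- `(1 + ‖ξ‖²)³` is integrable under the standard Gaussian (Fernique moments). [folklore] -/
theorem integrable_one_add_norm_sq_cube :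
    Integrable (fun ξ : V3 => (1 + ‖ξ‖ ^ 2) ^ 3) (stdGaussian V3) := by
  have h : (fun ξ : V3 => (1 + ‖ξ‖ ^ 2) ^ 3) =
      fun ξ => 1 + 3 * ‖ξ‖ ^ 2 + 3 * ‖ξ‖ ^ 4 + ‖ξ‖ ^ 6 := by
    funext ξ; ring
  rw [h]
  refine (((integrable_const _).add (integrable_norm_sq_stdGaussian.const_mul 3)).add
    (integrable_norm_pow_four_stdGaussian.const_mul 3)).add ?_
  exact (IsGaussian.memLp_id _ 6 (by simp)).integrable_norm_pow (by norm_num)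

/-- Domination by `K(1 + ‖ξ‖²)³` gives Gaussian integrability. [folklore] -/
theorem integrable_of_le_cube {h : V3 → ℝ} (hm : Continuous h) (K : ℝ)
    (hh : ∀ ξ, |h ξ| ≤ K * (1 + ‖ξ‖ ^ 2) ^ 3) : Integrable h (stdGaussian V3) :=
  (integrable_one_add_norm_sq_cube.const_mul K).mono' hm.aestronglyMeasurable
    (ae_of_all _ fun ξ => by rw [Real.norm_eq_abs]; exact hh ξ)

/-- A product of three factors of linear growth in `s` has cubic growth. [folklore] -/
theorem abs_mul_three_le {p q r P Q R s : ℝ} (hp : |p| ≤ P * (1 + s))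
    (hq : |q| ≤ Q * (1 + s)) (hr : |r| ≤ R * (1 + s)) :
    |p * q * r| ≤ P * Q * R * (1 + s) ^ 3 := by
  have hP : 0 ≤ P * (1 + s) := (abs_nonneg p).trans hp
  have hQ : 0 ≤ Q * (1 + s) := (abs_nonneg q).trans hq
  rw [abs_mul, abs_mul]
  calc |p| * |q| * |r| ≤ P * (1 + s) * (Q * (1 + s)) * (R * (1 + s)) :=
        mul_le_mul (mul_le_mul hp hq (abs_nonneg _) hP) hr (abs_nonneg _) (mul_nonneg hP hQ)
    _ = P * Q * R * (1 + s) ^ 3 := by ring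

/-- `|ξ_j| ≤ 1 + ‖ξ‖²`. [folklore] -/
theorem abs_coord_le (ξ : V3) (j : Fin 3) : |ξ j| ≤ 1 + ‖ξ‖ ^ 2 := by
  have h1 : |ξ j| ≤ ‖ξ‖ := by
    have := PiLp.norm_apply_le ξ j
    rwa [Real.norm_eq_abs] at this
  nlinarith [norm_nonneg ξ, sq_nonneg (‖ξ‖ - 1)]

/-- `|ξ_j| ≤ 1 · (1 + ‖ξ‖²)`. [folklore] -/
theorem abs_coord_le' (ξ : V3) (j : Fin 3) : |ξ j| ≤ 1 * (1 + ‖ξ‖ ^ 2) := by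
  rw [one_mul]; exact abs_coord_le ξ j

/-- A bound `x ≤ Q` by a nonnegative constant is a bound of linear growth. [folklore] -/
theorem le_mul_one_add {x Q s : ℝ} (hx : x ≤ Q) (hQ : 0 ≤ Q) (hs : 0 ≤ s) : x ≤ Q * (1 + s) :=
  hx.trans (le_mul_of_one_le_right hQ (by linarith))

/-- A continuous functional of quadratic growth is Gaussian-integrable against `1, ξ_j, ‖ξ‖²`.
[folklore] -/
theorem integrable_of_le_lin {h : V3 → ℝ} (hm : Continuous h) {K : ℝ}
    (hh : ∀ ξ, |h ξ| ≤ K * (1 + ‖ξ‖ ^ 2)) :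
    Integrable h (stdGaussian V3) ∧ (∀ j, Integrable (fun ξ => h ξ * ξ j) (stdGaussian V3)) ∧
      Integrable (fun ξ => h ξ * ‖ξ‖ ^ 2) (stdGaussian V3) := by
  have h1 : ∀ ξ : V3, |(1 : ℝ)| ≤ 1 * (1 + ‖ξ‖ ^ 2) := fun ξ => by
    rw [abs_one]; nlinarith [sq_nonneg ‖ξ‖]
  have h2 : ∀ ξ : V3, |‖ξ‖ ^ 2| ≤ 1 * (1 + ‖ξ‖ ^ 2) := fun ξ => by
    rw [abs_of_nonneg (sq_nonneg _)]; nlinarith [sq_nonneg ‖ξ‖]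
  refine ⟨integrable_of_le_cube hm (K * 1 * 1) fun ξ => ?_, fun j =>
    integrable_of_le_cube (by fun_prop) (K * 1 * 1) fun ξ => ?_,
    integrable_of_le_cube (by fun_prop) (K * 1 * 1) fun ξ => ?_⟩
  · simpa using abs_mul_three_le (hh ξ) (h1 ξ) (h1 ξ)
  · simpa using abs_mul_three_le (hh ξ) (abs_coord_le' ξ j) (h1 ξ)
  · simpa using abs_mul_three_le (hh ξ) (h2 ξ) (h1 ξ)

/-- `ξ_j ξ_k ω(‖ξ‖²)` is Gaussian-integrable for a continuous weight of linear growth. [folklore] -/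
theorem integrable_coord_mul_weight (j k : Fin 3) {ω : ℝ → ℝ} (hω : Continuous ω) {P : ℝ}
    (hP : ∀ s, 0 ≤ s → |ω s| ≤ P * (1 + s)) :
    Integrable (fun ξ : V3 => ξ j * ξ k * ω (‖ξ‖ ^ 2)) (stdGaussian V3) :=
  integrable_of_le_cube (by fun_prop) (1 * 1 * P) fun ξ =>
    abs_mul_three_le (abs_coord_le' ξ j) (abs_coord_le' ξ k) (hP _ (sq_nonneg _))

/-! ### Reduced moments: reflections and swaps
(adapted from Cruxes/KineticCurrentsWindowLDUniform/Disproof.lean § KineticCurrentsWindowLDUniformClass,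
refuter cdisprove-14662) -/

/-- Coordinates of the vector reflected in the `k`-th coordinate hyperplane. [folklore] -/
theorem piLpCongrRight_refl_apply (k : Fin 3) (ξ : V3) (i : Fin 3) :
    LinearIsometryEquiv.piLpCongrRight 2 (fun i : Fin 3 => if i = k then
      LinearIsometryEquiv.neg ℝ (E := ℝ) else LinearIsometryEquiv.refl ℝ ℝ) ξ i =
      if i = k then -ξ i else ξ i := by
  rw [LinearIsometryEquiv.piLpCongrRight_apply, PiLp.toLp_apply]
  split_ifs <;> simp

/-- Coordinates of the vector with coordinates `j ↔ k` swapped. [folklore] -/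
theorem piLpCongrLeft_swap_apply (j k : Fin 3) (ξ : V3) (i : Fin 3) :
    LinearIsometryEquiv.piLpCongrLeft 2 ℝ ℝ (Equiv.swap j k) ξ i = ξ (Equiv.swap j k i) := by
  simp [LinearIsometryEquiv.piLpCongrLeft_apply, Equiv.piCongrLeft'_apply, Equiv.symm_swap]

/-- Off-diagonal reduced moments vanish: `E[ξ_j ξ_k κ(‖ξ‖²)] = 0` for `j ≠ k`. [folklore] -/
theorem integral_offdiag_eq_zero {j k : Fin 3} (hjk : j ≠ k) (κ : ℝ → ℝ) :
    ∫ ξ, ξ j * ξ k * κ (‖ξ‖ ^ 2) ∂stdGaussian V3 = 0 := by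
  -- the integrand is odd under the reflection `ξ_j ↦ -ξ_j`, which preserves `γ`
  have h := integral_comp_linearIsometryEquiv_stdGaussian (LinearIsometryEquiv.piLpCongrRight 2
    (fun i : Fin 3 => if i = j then LinearIsometryEquiv.neg ℝ (E := ℝ) else
      LinearIsometryEquiv.refl ℝ ℝ)) (fun ξ : V3 => ξ j * ξ k * κ (‖ξ‖ ^ 2))
  simp only [piLpCongrRight_refl_apply, LinearIsometryEquiv.norm_map, if_true, if_neg hjk.symm,
    neg_mul, integral_neg] at h
  linarith

/-- Diagonal reduced moments agree: `E[ξ_j² κ(‖ξ‖²)] = E[ξ_0² κ(‖ξ‖²)]`. [folklore] -/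
theorem integral_diag_eq (j : Fin 3) (κ : ℝ → ℝ) :
    ∫ ξ, ξ j * ξ j * κ (‖ξ‖ ^ 2) ∂stdGaussian V3 =
      ∫ ξ, ξ 0 * ξ 0 * κ (‖ξ‖ ^ 2) ∂stdGaussian V3 := by
  have h := integral_comp_linearIsometryEquiv_stdGaussian
    (LinearIsometryEquiv.piLpCongrLeft 2 ℝ ℝ (Equiv.swap (0 : Fin 3) j))
    (fun ξ : V3 => ξ 0 * ξ 0 * κ (‖ξ‖ ^ 2))
  simp only [piLpCongrLeft_swap_apply, LinearIsometryEquiv.norm_map, Equiv.swap_apply_left] at h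
  exact h

/-- `(∑ A_{jk} ξ_j ξ_k) ω(‖ξ‖²)` is Gaussian-integrable for a continuous weight of linear growth.
[folklore] -/
theorem integrable_quad_weight (A : Fin 3 → Fin 3 → ℝ) {ω : ℝ → ℝ} (hω : Continuous ω) {P : ℝ}
    (hP : ∀ s, 0 ≤ s → |ω s| ≤ P * (1 + s)) :
    Integrable (fun ξ : V3 => (∑ j, ∑ k, A j k * (ξ j * ξ k)) * ω (‖ξ‖ ^ 2)) (stdGaussian V3) := by
  have h : (fun ξ : V3 => (∑ j, ∑ k, A j k * (ξ j * ξ k)) * ω (‖ξ‖ ^ 2)) =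
      fun ξ => ∑ j, ∑ k, A j k * (ξ j * ξ k * ω (‖ξ‖ ^ 2)) := by
    funext ξ; simp only [Finset.sum_mul]
    refine Finset.sum_congr rfl fun j _ => Finset.sum_congr rfl fun k _ => ?_; ring
  rw [h]
  exact integrable_finsetSum _ fun j _ => integrable_finsetSum _ fun k _ =>
    (integrable_coord_mul_weight j k hω hP).const_mul _

/-- `∫ (∑ A_{jk} ξ_j ξ_k) ω(‖ξ‖²) dγ = tr A · E[ξ_0² ω(‖ξ‖²)]` (reflections and swaps). [folklore] -/
theorem integral_quad_weight (A : Fin 3 → Fin 3 → ℝ) {ω : ℝ → ℝ} (hω : Continuous ω) {P : ℝ}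
    (hP : ∀ s, 0 ≤ s → |ω s| ≤ P * (1 + s)) :
    ∫ ξ, (∑ j, ∑ k, A j k * (ξ j * ξ k)) * ω (‖ξ‖ ^ 2) ∂stdGaussian V3 =
      (∑ j, A j j) * ∫ ξ, ξ 0 * ξ 0 * ω (‖ξ‖ ^ 2) ∂stdGaussian V3 := by
  have h : ∀ ξ : V3, (∑ j, ∑ k, A j k * (ξ j * ξ k)) * ω (‖ξ‖ ^ 2) =
      ∑ j, ∑ k, A j k * (ξ j * ξ k * ω (‖ξ‖ ^ 2)) := by
    intro ξ; simp only [Finset.sum_mul]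
    refine Finset.sum_congr rfl fun j _ => Finset.sum_congr rfl fun k _ => ?_; ring
  simp_rw [h]
  rw [integral_finsetSum _ fun j _ => integrable_finsetSum _ fun k _ =>
    (integrable_coord_mul_weight j k hω hP).const_mul _]
  have hjk : ∀ j k : Fin 3, ∫ ξ, A j k * (ξ j * ξ k * ω (‖ξ‖ ^ 2)) ∂stdGaussian V3 =
      if j = k then A j j * ∫ ξ, ξ 0 * ξ 0 * ω (‖ξ‖ ^ 2) ∂stdGaussian V3 else 0 := by
    intro j k
    rw [integral_const_mul]
    split_ifs with hjk
    · subst hjk; rw [integral_diag_eq]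
    · rw [integral_offdiag_eq_zero hjk, mul_zero]
  simp_rw [integral_finsetSum _ fun k _ => (integrable_coord_mul_weight _ k hω hP).const_mul _, hjk]
  simp [Finset.sum_ite_eq, Finset.sum_mul]

/-- `∫ (b·ξ) ξ_j ω(‖ξ‖²) dγ = b_j · E[ξ_0² ω(‖ξ‖²)]`. [folklore] -/
theorem integral_lin_mul_coord_weight (b : V3) (j : Fin 3) {ω : ℝ → ℝ} (hω : Continuous ω)
    {P : ℝ} (hP : ∀ s, 0 ≤ s → |ω s| ≤ P * (1 + s)) :
    ∫ ξ, (∑ k, b k * ξ k) * ξ j * ω (‖ξ‖ ^ 2) ∂stdGaussian V3 =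
      b j * ∫ ξ, ξ 0 * ξ 0 * ω (‖ξ‖ ^ 2) ∂stdGaussian V3 := by
  have h : ∀ ξ : V3, (∑ k, b k * ξ k) * ξ j * ω (‖ξ‖ ^ 2) =
      ∑ k, b k * (ξ k * ξ j * ω (‖ξ‖ ^ 2)) := by
    intro ξ; simp only [Finset.sum_mul]
    refine Finset.sum_congr rfl fun k _ => ?_; ring
  simp_rw [h]
  rw [integral_finsetSum _ fun k _ => (integrable_coord_mul_weight k j hω hP).const_mul _]
  have hk : ∀ k : Fin 3, ∫ ξ, b k * (ξ k * ξ j * ω (‖ξ‖ ^ 2)) ∂stdGaussian V3 =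
      if k = j then b j * ∫ ξ, ξ 0 * ξ 0 * ω (‖ξ‖ ^ 2) ∂stdGaussian V3 else 0 := by
    intro k
    rw [integral_const_mul]
    split_ifs with hkj
    · subst hkj; rw [integral_diag_eq]
    · rw [integral_offdiag_eq_zero hkj, mul_zero]
  simp_rw [hk]
  simp [Finset.sum_ite_eq']

/-! ### Class-form functionals in the reduced variable: even and first moments -/

/-- **Even moments of a class-form functional.** For
`h(ξ) = θ (∑ A_{jk} ξ_j ξ_k) κ(‖ξ‖²) + √θ (b·ξ) λ(‖ξ‖²)` and an even radial weight `ϖ(‖ξ‖²)`,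
`∫ h ϖ dγ = θ · tr A · E[ξ_0² κϖ]`: the odd `b`-part drops out. [folklore] -/
theorem integral_classForm_mul_even {h : V3 → ℝ} {θ : ℝ} {A : Fin 3 → Fin 3 → ℝ} {b : V3}
    {κ lam ϖ : ℝ → ℝ}
    (hh : ∀ ξ, h ξ = θ * (∑ j, ∑ k, A j k * (ξ j * ξ k)) * κ (‖ξ‖ ^ 2) +
      Real.sqrt θ * (∑ j, b j * ξ j) * lam (‖ξ‖ ^ 2))
    (hω : Continuous fun s => κ s * ϖ s) {P : ℝ} (hP : ∀ s, 0 ≤ s → |κ s * ϖ s| ≤ P * (1 + s))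
    (hint : Integrable (fun ξ => h ξ * ϖ (‖ξ‖ ^ 2)) (stdGaussian V3)) :
    ∫ ξ, h ξ * ϖ (‖ξ‖ ^ 2) ∂stdGaussian V3 =
      θ * (∑ j, A j j) * ∫ ξ, ξ 0 * ξ 0 * (κ (‖ξ‖ ^ 2) * ϖ (‖ξ‖ ^ 2)) ∂stdGaussian V3 := by
  have he : Integrable (fun ξ : V3 => (∑ j, ∑ k, A j k * (ξ j * ξ k)) *
      (κ (‖ξ‖ ^ 2) * ϖ (‖ξ‖ ^ 2))) (stdGaussian V3) := integrable_quad_weight A hω hP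
  have ho : Integrable (fun ξ : V3 => h ξ * ϖ (‖ξ‖ ^ 2) -
      θ * ((∑ j, ∑ k, A j k * (ξ j * ξ k)) * (κ (‖ξ‖ ^ 2) * ϖ (‖ξ‖ ^ 2)))) (stdGaussian V3) :=
    hint.sub (he.const_mul θ)
  have ho0 : ∫ ξ, (h ξ * ϖ (‖ξ‖ ^ 2) -
      θ * ((∑ j, ∑ k, A j k * (ξ j * ξ k)) * (κ (‖ξ‖ ^ 2) * ϖ (‖ξ‖ ^ 2)))) ∂stdGaussian V3 = 0 := by
    refine integral_eq_zero_of_odd_stdGaussian fun ξ => ?_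
    simp only [hh, norm_neg, PiLp.neg_apply, mul_neg, neg_mul, neg_neg, Finset.sum_neg_distrib]
    ring
  have hsplit : (fun ξ : V3 => h ξ * ϖ (‖ξ‖ ^ 2)) = fun ξ =>
      θ * ((∑ j, ∑ k, A j k * (ξ j * ξ k)) * (κ (‖ξ‖ ^ 2) * ϖ (‖ξ‖ ^ 2))) +
      (h ξ * ϖ (‖ξ‖ ^ 2) -
        θ * ((∑ j, ∑ k, A j k * (ξ j * ξ k)) * (κ (‖ξ‖ ^ 2) * ϖ (‖ξ‖ ^ 2)))) := by
    funext ξ; ring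
  rw [hsplit, integral_add (he.const_mul θ) ho, ho0, add_zero, integral_const_mul,
    integral_quad_weight A hω hP, mul_assoc]

/-- **First moments of a class-form functional.** For
`h(ξ) = θ (∑ A_{jk} ξ_j ξ_k) κ(‖ξ‖²) + √θ (b·ξ) λ(‖ξ‖²)` with bounded `κ` and `λ` of linear growth,
`∫ h ξ_j dγ = √θ · b_j · E[ξ_0² λ(‖ξ‖²)]`: the even `A`-part drops out. [folklore] -/
theorem integral_classForm_mul_coord {h : V3 → ℝ} {θ : ℝ} {A : Fin 3 → Fin 3 → ℝ} {b : V3}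
    {κ lam : ℝ → ℝ}
    (hh : ∀ ξ, h ξ = θ * (∑ j, ∑ k, A j k * (ξ j * ξ k)) * κ (‖ξ‖ ^ 2) +
      Real.sqrt θ * (∑ j, b j * ξ j) * lam (‖ξ‖ ^ 2))
    (hκ : Continuous κ) {P : ℝ} (hP : ∀ s, 0 ≤ s → |κ s| ≤ P)
    (hlam : Continuous lam) {Q : ℝ} (hQ : ∀ s, 0 ≤ s → |lam s| ≤ Q * (1 + s)) (j : Fin 3) :
    ∫ ξ, h ξ * ξ j ∂stdGaussian V3 =
      Real.sqrt θ * b j * ∫ ξ, ξ 0 * ξ 0 * lam (‖ξ‖ ^ 2) ∂stdGaussian V3 := by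
  have h1 : Integrable (fun ξ : V3 => (∑ i, ∑ k, A i k * (ξ i * ξ k)) * κ (‖ξ‖ ^ 2) * ξ j)
      (stdGaussian V3) := by
    have e : (fun ξ : V3 => (∑ i, ∑ k, A i k * (ξ i * ξ k)) * κ (‖ξ‖ ^ 2) * ξ j) =
        fun ξ => ∑ i, ∑ k, A i k * ξ i * ξ k * (κ (‖ξ‖ ^ 2) * ξ j) := by
      funext ξ; simp only [Finset.sum_mul]
      refine Finset.sum_congr rfl fun i _ => Finset.sum_congr rfl fun k _ => ?_; ring
    rw [e]
    refine integrable_finsetSum _ fun i _ => integrable_finsetSum _ fun k _ =>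
      integrable_of_le_cube (by fun_prop) (|A i k| * 1 * P) fun ξ =>
        abs_mul_three_le ?_ (abs_coord_le' ξ k) ?_
    · rw [abs_mul]; exact mul_le_mul_of_nonneg_left (abs_coord_le ξ i) (abs_nonneg _)
    · rw [abs_mul]
      exact mul_le_mul (hP (‖ξ‖ ^ 2) (sq_nonneg ‖ξ‖)) (abs_coord_le ξ j) (abs_nonneg _)
        ((abs_nonneg _).trans (hP (‖ξ‖ ^ 2) (sq_nonneg ‖ξ‖)))
  have h1' : ∫ ξ, (∑ i, ∑ k, A i k * (ξ i * ξ k)) * κ (‖ξ‖ ^ 2) * ξ j ∂stdGaussian V3 = 0 := by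
    refine integral_eq_zero_of_odd_stdGaussian fun ξ => ?_
    simp only [norm_neg, PiLp.neg_apply, mul_neg, neg_mul, neg_neg]
  have h2 : Integrable (fun ξ : V3 => (∑ k, b k * ξ k) * ξ j * lam (‖ξ‖ ^ 2)) (stdGaussian V3) := by
    have e : (fun ξ : V3 => (∑ k, b k * ξ k) * ξ j * lam (‖ξ‖ ^ 2)) =
        fun ξ => ∑ k, b k * (ξ k * ξ j * lam (‖ξ‖ ^ 2)) := by
      funext ξ; simp only [Finset.sum_mul]
      refine Finset.sum_congr rfl fun k _ => ?_; ring
    rw [e]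
    exact integrable_finsetSum _ fun k _ => (integrable_coord_mul_weight k j hlam hQ).const_mul _
  have hsplit : (fun ξ : V3 => h ξ * ξ j) = fun ξ =>
      θ * ((∑ i, ∑ k, A i k * (ξ i * ξ k)) * κ (‖ξ‖ ^ 2) * ξ j) +
        Real.sqrt θ * ((∑ k, b k * ξ k) * ξ j * lam (‖ξ‖ ^ 2)) := by
    funext ξ; rw [hh]; ring
  rw [hsplit, integral_add (h1.const_mul θ) (h2.const_mul _), integral_const_mul,
    integral_const_mul, h1', mul_zero, zero_add, integral_lin_mul_coord_weight b j hlam hQ,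
    mul_assoc]

/-! ### The reference weight, the exponential tail bound, the cutoff -/

/-- The reference weight `s ↦ (1 + |s|)⁻¹` is continuous. [folklore] -/
theorem continuous_refWeight : Continuous fun s : ℝ => (1 + |s|)⁻¹ :=
  (continuous_const.add continuous_abs).inv₀ fun s => (by positivity : (0 : ℝ) < 1 + |s|).ne'

/-- The reference weight is bounded by `1`. [folklore] -/
theorem abs_refWeight_le (s : ℝ) (hs : 0 ≤ s) : |(1 + |s|)⁻¹| ≤ 1 * (1 + s) := by
  rw [abs_of_nonneg (by positivity), one_mul]
  exact (inv_le_one_of_one_le₀ (by linarith [abs_nonneg s])).trans (by linarith)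

/-- The reference radial moment `m₀ = E[ξ_0² (1 + ‖ξ‖²)⁻¹]` is positive. [folklore] -/
theorem refMoment_pos : 0 < ∫ ξ, ξ 0 * ξ 0 * (1 + |‖ξ‖ ^ 2|)⁻¹ ∂stdGaussian V3 := by
  have hint := integrable_coord_mul_weight 0 0 continuous_refWeight abs_refWeight_le
  have hnn : 0 ≤ᵐ[stdGaussian V3] fun ξ : V3 => ξ 0 * ξ 0 * (1 + |‖ξ‖ ^ 2|)⁻¹ :=
    ae_of_all _ fun ξ => mul_nonneg (mul_self_nonneg _) (inv_nonneg.2 (by positivity))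
  refine (integral_nonneg_of_ae hnn).lt_of_ne fun h0 => ?_
  rw [eq_comm, integral_eq_zero_iff_of_nonneg_ae hnn hint] at h0
  have h2 : (fun ξ : V3 => ξ 0 ^ 2) =ᵐ[stdGaussian V3] fun _ => 0 := by
    filter_upwards [h0] with ξ hξ
    have hpos : (0 : ℝ) < (1 + |‖ξ‖ ^ 2|)⁻¹ := inv_pos.2 (by positivity)
    have hξ' : ξ 0 * ξ 0 * (1 + |‖ξ‖ ^ 2|)⁻¹ = 0 := hξ
    rcases mul_eq_zero.1 hξ' with h | h
    · rw [sq, h]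
    · exact absurd h hpos.ne'
  have h3 := integral_coord_sq_stdGaussian (ι := Fin 3) 0
  rw [integral_congr_ae h2, integral_const, smul_zero] at h3
  exact zero_ne_one h3

/-- Convexity bound `e^{tz} ≤ 1 + t e^{z}` for `t ∈ [0,1]`. [folklore] -/
theorem exp_mul_le_one_add_mul_exp {t z : ℝ} (ht0 : 0 ≤ t) (ht1 : t ≤ 1) :
    Real.exp (t * z) ≤ 1 + t * Real.exp z := by
  have h := convexOn_exp.2 (Set.mem_univ 0) (Set.mem_univ z) (sub_nonneg.2 ht1) ht0 (by ring)
  simp only [smul_eq_mul, mul_zero, zero_add, Real.exp_zero, mul_one] at h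
  linarith [mul_nonneg ht0 (Real.exp_pos z).le]

/-- Pointwise exponential tail bound behind the exponential-moment estimate: with
`κ₀ = a/(K+1)`, `c ≤ K(1+s)`, `0 ≤ t ≤ 1`, `t ≤ m s`:
`exp(κ₀(ct + δ)) ≤ exp(κ₀δ)(1 + m (eᵃ/a) e^{2as})` (convexity of `exp`, `s ≤ e^{as}/a`).
[folklore] -/
theorem exp_tail_bound {a K c t s δ m : ℝ} (ha : 0 < a) (hK : 0 ≤ K) (hcK : c ≤ K * (1 + s))
    (hs : 0 ≤ s) (ht0 : 0 ≤ t) (ht1 : t ≤ 1) (htm : t ≤ m * s) (hm : 0 ≤ m) :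
    Real.exp (a / (K + 1) * (c * t + δ)) ≤
      Real.exp (a / (K + 1) * δ) * (1 + m * (Real.exp a / a * Real.exp (2 * a * s))) := by
  have hκ0 : 0 ≤ a / (K + 1) := by positivity
  have hκK : a / (K + 1) * K ≤ a := by
    rw [div_mul_eq_mul_div, div_le_iff₀ (by positivity)]; nlinarith
  have h1 : a / (K + 1) * (c * t) ≤ t * (a * (1 + s)) := by
    calc a / (K + 1) * (c * t) ≤ a / (K + 1) * (K * (1 + s) * t) :=
          mul_le_mul_of_nonneg_left (mul_le_mul_of_nonneg_right hcK ht0) hκ0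
      _ = a / (K + 1) * K * ((1 + s) * t) := by ring
      _ ≤ a * ((1 + s) * t) := mul_le_mul_of_nonneg_right hκK (by positivity)
      _ = t * (a * (1 + s)) := by ring
  have h2 : t * Real.exp (a * (1 + s)) ≤ m * (Real.exp a / a * Real.exp (2 * a * s)) := by
    have hs' : s ≤ Real.exp (a * s) / a := by
      rw [le_div_iff₀ ha]; nlinarith [Real.add_one_le_exp (a * s)]
    calc t * Real.exp (a * (1 + s)) ≤ m * s * Real.exp (a * (1 + s)) :=
          mul_le_mul_of_nonneg_right htm (Real.exp_pos _).le
      _ = m * (s * Real.exp (a * s)) * Real.exp a := by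
          rw [mul_add, mul_one, Real.exp_add]; ring
      _ ≤ m * (Real.exp (a * s) / a * Real.exp (a * s)) * Real.exp a := by gcongr
      _ = m * (Real.exp a / a * Real.exp (2 * a * s)) := by
          rw [show 2 * a * s = a * s + a * s by ring, Real.exp_add]; ring
  calc Real.exp (a / (K + 1) * (c * t + δ))
      = Real.exp (a / (K + 1) * (c * t)) * Real.exp (a / (K + 1) * δ) := by
        rw [← Real.exp_add]; congr 1; ring
    _ ≤ Real.exp (t * (a * (1 + s))) * Real.exp (a / (K + 1) * δ) := by gcongr
    _ ≤ (1 + t * Real.exp (a * (1 + s))) * Real.exp (a / (K + 1) * δ) := by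
        gcongr; exact exp_mul_le_one_add_mul_exp ht0 ht1
    _ ≤ (1 + m * (Real.exp a / a * Real.exp (2 * a * s))) * Real.exp (a / (K + 1) * δ) := by
        gcongr
    _ = _ := by ring

/-- The cutoff `χ_L(s) = min 1 (max 0 (2 − s/L))` (`L > 0`): continuous, values in `[0,1]`,
`= 0` on `s ≥ 2L`, and `1 − χ_L(s) ≤ s/L` for `s ≥ 0` (it is `= 1` on `s ≤ L`). [folklore] -/
theorem cutoff_props {L : ℝ} (hL : 0 < L) {χ : ℝ → ℝ}
    (hχ : ∀ s, χ s = min 1 (max 0 (2 - s / L))) :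
    Continuous χ ∧ (∀ s, 0 ≤ χ s) ∧ (∀ s, χ s ≤ 1) ∧ (∀ s, 2 * L ≤ s → χ s = 0) ∧
      ∀ s, 0 ≤ s → 1 - χ s ≤ 1 / L * s := by
  have hfun : χ = fun s => min 1 (max 0 (2 - s / L)) := funext hχ
  have h0 : ∀ s, 0 ≤ χ s := fun s => by rw [hχ]; exact le_min zero_le_one (le_max_left _ _)
  refine ⟨by rw [hfun]; fun_prop, h0, fun s => by rw [hχ]; exact min_le_left _ _,
    fun s hs => ?_, fun s hs => ?_⟩
  · have : 2 - s / L ≤ 0 := by rw [sub_nonpos, le_div_iff₀ hL]; linarith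
    rw [hχ, max_eq_left this, min_eq_right zero_le_one]
  · rw [one_div_mul_eq_div]
    by_cases h : s ≤ L
    · have h' : s / L ≤ 1 := (div_le_one hL).2 h
      rw [hχ, max_eq_right (by linarith), min_eq_left (by linarith), sub_self]
      exact div_nonneg hs hL.le
    · have : 1 ≤ s / L := by rw [le_div_iff₀ hL]; linarith [not_le.1 h]
      linarith [h0 s]

end ClassTruncation

/-- **Registered helper stub `stub_classTruncation_gauss`** (helper file A of S3, line `Sketch`,
crux stmt-AtomisticToContinuum-14662): the Gaussian quadratic-form moment identity
`∫ (∑ A_{jk} ξ_j ξ_k) ω(‖ξ‖²) dγ = tr A · E[ξ_0² ω(‖ξ‖²)]` for a continuous radial weight of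
linear growth (coordinate reflections kill the off-diagonal moments, swaps identify the diagonal
ones). [folklore] -/
theorem stub_classTruncation_gauss :
    ∀ (A : Fin 3 → Fin 3 → ℝ) (ω : ℝ → ℝ), Continuous ω →
      ∀ P : ℝ, (∀ s : ℝ, 0 ≤ s → |ω s| ≤ P * (1 + s)) →
      ∫ ξ, (∑ j : Fin 3, ∑ k : Fin 3, A j k * (ξ j * ξ k)) * ω (‖ξ‖ ^ 2)
          ∂ProbabilityTheory.stdGaussian V3 =
        (∑ j : Fin 3, A j j) * ∫ ξ, ξ 0 * ξ 0 * ω (‖ξ‖ ^ 2) ∂ProbabilityTheory.stdGaussian V3 :=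
  fun A _ω hω _P hP => ClassTruncation.integral_quad_weight A hω hP

end Summit.AtomisticToContinuum.HydrodynamicLimit.Theorems.KineticCurrentsWindowLDUniformSketch

end
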